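import Summits.BirchSwinnertonDyer.BirchSwinnertonDyer.Theorems.SignedLowerHalvesSprungLowerDivisibilityAtThreeSqueezeToCommonZeros
import Summits.BirchSwinnertonDyer.BirchSwinnertonDyer.Theorems.SignedLowerHalvesSprungLowerDivisibilityAtThreeStubPeriodMu
import HarnessLib

/-!
# Crux K1 `SprungLowerDivisibilityAtThree` (stmt-BirchSwinnertonDyer-19875), line `chromatic-common-zeros`:
# the PER-PAIR DOOR «coprime chromatic pair ⟹ the Eisenstein half for BOTH colours», image-free, rank-free
# (`--supports` 19875 as helper; closes nothing by itself)

Composition of the two landed stubs S1 (`ChromaticCommonZeros.stub_squeezeToCommonZeros`, the reduction of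
the Eisenstein half of Sprung's ♯/♭ main conjecture to the COMMON-ZERO LOCUS of the Néron-normalised
`(ϖL♯, ϖL♭)`) and S3 (`ChromaticCommonZeros.stub_periodMu`, `(3)` is never a common zero) of the line
`Cruxes/SprungLowerDivisibilityAtThree/Lines/chromatic_common_zeros.lean`, in the currency of the lead's reshaped
skeleton (the joint ♯/♭ Coleman–Kato package as binders `I, Cs, Cf, Cs.Z = Cf.Z`; Thm. 7.14's output as binders
`[Module.Finite Λ D.X]`, `Module.IsTorsion Λ D.X`; the period unit at `3` as the named binder `h3`):

* `ChromaticCommonZeros.no_common_zero_of_bezout` — on an X8 pair, a BÉZOUT CERTIFICATE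
  `a·L♯ + b·L♭ = C(p^k)` for the Sprung pair forces every height-one prime containing the normalised
  `L`-function of EVERY colour to contain `p`, which S3 forbids: the common-zero locus is EMPTY.
* `ChromaticCommonZeros.lowerDivisibility_of_bezout` — hence, for every colour `•` with `L^• ≠ 0` and every
  dual datum `D` of `Sel^•(E/ℚ_∞)` in K1's binder telescope, `char_Λ X^• = (gen)` with
  `ι gen = C(ϖ)·ι(L^•·h)`: the conclusion of `Theorems.SprungSharpFlatLowerDivisibility W p •` for `D`.

This is the card's census door («every X8 cell with a certified coprime pair closes K1 for BOTH colours
image-free»): per pair the certificate is ONE identity in `Λ = ℤ₃⟦T⟧` (equivalently: the `3`-adic resultant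
of the distinguished parts of `L♯, L♭` is non-zero AND no cyclotomic common zero — it subsumes S2 AND S4 for
that pair). No certificate is supplied here; class X8-wide the common-zero locus is the subject of the open
stubs S2 (`stub_chromaticCoprimality`) and S4 (`stub_cyclotomicLower`). K1, Sprung's main conjecture and BSD on
leaf X8 are NOT proved by this file.

References: [Sprung2012] Def. 6.1, Thm. 7.14 (3), Prop. 7.19, Main Conj. 7.21; [Kato2004Asterisque] Thm. 12.5/12.6;
[KuriharaPollack2007] Problem 3.2; [GreenbergVatsal2000] §3 Rem. 3.4; [Washington1997] §13.2.
-/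

set_option autoImplicit false
-- justification: the mandated namespace `Summit.BirchSwinnertonDyer.BirchSwinnertonDyer.Theorems`
-- (single-conjunct summit, Sub = Summit) repeats a segment by design (D-0017).
set_option linter.dupNamespace false

noncomputable section

open scoped Classical NumberField MatrixGroups ModularForm

open NumberField IsDedekindDomain CongruenceSubgroup WeierstrassCurve Field
  Literature.NumberTheory.EllipticCurves Literature.NumberTheory.EllipticCurves.ModularForms
  Literature.NumberTheory.EllipticCurves.ZpExtension Literature.NumberTheory.EllipticCurves.Sprung2017
  Literature.NumberTheory.EllipticCurves.Sprung2012 Literature.NumberTheory.EllipticCurves.Rank1Residual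
  Literature.NumberTheory.EllipticCurves.IwasawaAlgebra
  Summit.BirchSwinnertonDyer.BirchSwinnertonDyer.Theorems

namespace Summit.BirchSwinnertonDyer.BirchSwinnertonDyer.Theorems.ChromaticCommonZeros

/-- **A Bézout certificate empties the common-zero locus.** On an X8 pair (`p = 3`, good supersingular,
`a₃ = ±3`), for a newform `f` of `W`, a period ratio `ϖ` (`ϖ·Ω_E = Ω⁺_f`) and a Sprung pair `(L♯, L♭)`: if
`a·L♯ + b·L♭ = C(p^k)` for some `a, b ∈ Λ`, `k ∈ ℕ`, then NO height-one prime `𝔭` of `Λ` contains the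
Néron-normalised `L`-function `G^{•}` (`ι G^• = C(ϖ)·ι L^•`) of every colour `•`. Proof: `ϖ ∈ ℤ₃ˣ`
(`norm_periodRatio_eq_one_of_classX8`, from `h3`), so `G^• = C(ϖ)·L^•` and `L♯, L♭ ∈ 𝔭`, hence `C(p^k) ∈ 𝔭`,
`p ∈ 𝔭`; but by S3 (`stub_periodMu`: THEOREM B of the x8 cell) some colour's `G^{col₀}` avoids every
height-one prime containing `p`. [cite: GreenbergVatsal2000, §3 Rem. 3.4] [cite: Sprung2017, Cor. 4.10, Thm. 1.12]
[cite: Washington1997, §13.2] -/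
theorem no_common_zero_of_bezout (h3 : realPeriodRat_eq_unit_mul_plusPeriod_three)
    (W : WeierstrassCurve ℚ) [W.IsElliptic] [W.IsGloballyMinimal] (p : ℕ) [Fact p.Prime]
    (hX : ClassX8 W p) {N : ℕ} [hN : NeZero N] (f : CuspForm (Gamma0 N) 2) (ϖ : ℚ)
    (Lsharp Lflat : IwasawaAlgebra p) (hf : IsNewformOf W f)
    (hϖ : (ϖ : ℝ) * W.realPeriodRat = plusPeriod f)
    (hSP : IsSprungPair f p (W.frobeniusTrace p) Lsharp Lflat)
    (hbez : ∃ (a b : IwasawaAlgebra p) (k : ℕ), a * Lsharp + b * Lflat = PowerSeries.C ((p : ℤ_[p]) ^ k))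
    (𝔭 : PrimeSpectrum (IwasawaAlgebra p)) (h𝔭 : 𝔭.asIdeal.height = 1)
    (hcommon : ∀ (col' : Chroma) (G' : IwasawaAlgebra p),
      iwasawaToPowerSeries p G' =
        PowerSeries.C (ϖ : ℚ_[p]) * iwasawaToPowerSeries p (chromaticL col' Lsharp Lflat) →
      G' ∈ 𝔭.asIdeal) : False := by
  -- the period ratio as a unit of `ℤ_p`
  have hnorm : ‖(ϖ : ℚ_[p])‖ = 1 := norm_periodRatio_eq_one_of_classX8 h3 W p hX f hf ϖ hϖ
  set u : ℤ_[p] := ⟨(ϖ : ℚ_[p]), hnorm.le⟩ with hu_def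
  have hu : IsUnit u := PadicInt.isUnit_iff.mpr hnorm
  have hcoe : (u : ℚ_[p]) = (ϖ : ℚ_[p]) := rfl
  have hCu : IsUnit (PowerSeries.C u : IwasawaAlgebra p) := (PowerSeries.C (R := ℤ_[p])).isUnit_map hu
  -- every colour's `L`-function lies in `𝔭`
  have hLmem : ∀ col' : Chroma, chromaticL col' Lsharp Lflat ∈ 𝔭.asIdeal := by
    intro col'
    have hmem := hcommon col' (PowerSeries.C u * chromaticL col' Lsharp Lflat)
      (by rw [iwasawaToPowerSeries_C_mul, hcoe])
    rcases 𝔭.isPrime.mem_or_mem hmem with hC | hL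
    · exact absurd (Ideal.eq_top_of_isUnit_mem _ hC hCu) 𝔭.isPrime.ne_top
    · exact hL
  -- hence `C(p^k) ∈ 𝔭` and `p ∈ 𝔭`
  obtain ⟨a, b, k, hab⟩ := hbez
  have hpk : (PowerSeries.C ((p : ℤ_[p]) ^ k) : IwasawaAlgebra p) ∈ 𝔭.asIdeal := by
    rw [← hab]
    exact 𝔭.asIdeal.add_mem (𝔭.asIdeal.mul_mem_left a (hLmem Chroma.sharp))
      (𝔭.asIdeal.mul_mem_left b (hLmem Chroma.flat))
  have hp𝔭 : (p : IwasawaAlgebra p) ∈ 𝔭.asIdeal := by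
    rw [map_pow, map_natCast] at hpk
    exact 𝔭.isPrime.mem_of_pow_mem k hpk
  -- but THEOREM B's colour avoids every height-one prime containing `p`
  obtain ⟨-, col₀, G₀, hG₀, hμ⟩ := stub_periodMu h3 W p hX N hN f ϖ Lsharp Lflat hf hϖ hSP
  exact hμ 𝔭 h𝔭 hp𝔭 (hcommon col₀ G₀ hG₀)

/-- **PER-PAIR DOOR: a coprime chromatic pair gives the Eisenstein half for BOTH colours (image-free,
rank-free).** In the binder telescope of `Theorems.SprungSharpFlatLowerDivisibility W p •` on class X8 — for
every colour `•` with `L^• ≠ 0`, every dual datum `D` of `Sel^•(E/ℚ_∞)` that is finitely generated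
`Λ`-torsion (Sprung 2012 Thm. 7.14), every Néron-normalised `G` and every JOINT ♯/♭ Coleman–Kato package
`Cs, Cf` on one pinned `I` with `Cs.Z = Cf.Z` — a Bézout certificate `a·L♯ + b·L♭ = C(p^k)` for the Sprung pair
yields `char_Λ X^• = (gen)` with `ι gen = C(ϖ)·ι(L^•·h)`. Proof: S1 (`stub_squeezeToCommonZeros`) reduces the
claim to the local inequality at the common zeros, and there are none (`no_common_zero_of_bezout`). The
census door of the line card; the certificate itself (per pair: a `3`-adic resultant and the absence of
cyclotomic common zeros) is NOT supplied here. CONDITIONAL on `h3` and on the displayed binders.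
[cite: Sprung2012, Thm. 7.14 (3) (p. 1504), Prop. 7.19 and Main Conj. 7.21 (p. 1505)]
[cite: Kato2004Asterisque, Thm. 12.5 and Thm. 12.6 (p. 222)] [cite: KuriharaPollack2007, Problem 3.2] -/
theorem lowerDivisibility_of_bezout (h3 : realPeriodRat_eq_unit_mul_plusPeriod_three) :
    ∀ (W : WeierstrassCurve ℚ) [W.IsElliptic] [W.IsGloballyMinimal] (p : ℕ) [Fact p.Prime]
      [ContinuousSMul ℤ_[p] (W.tateModule p)] [Module.Free ℤ_[p] (W.tateModule p)]
      [Module.Finite ℤ_[p] (W.tateModule p)],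
      ClassX8 W p → ∀ (col : Chroma) (κ : ZpExtension ℚ p) (γ : Field.absoluteGaloisGroup ℚ),
      κ.IsCyclotomic → κ.IsTopGenerator γ → IsCyclotomicVariable p γ →
    ∀ (v : HeightOneSpectrum (𝓞 ℚ)), (p : 𝓞 ℚ) ∈ v.asIdeal →
    ∀ (g : Field.absoluteGaloisGroup (v.adicCompletion ℚ)),
      κ.IsTopGenerator (resGalOfEmb (closureEmb (K := ℚ) (v.adicCompletion ℚ)) g) →
    ∀ (cneg : localPoints W (v.adicCompletion ℚ)) (c : ℕ → localPoints W (v.adicCompletion ℚ)),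
      IsHondaSystem κ (closureEmb (K := ℚ) (v.adicCompletion ℚ)) W (W.frobeniusTrace p) g cneg c →
    ∀ (N : ℕ) (_ : NeZero N) (f : CuspForm (Gamma0 N) 2) (ϖ : ℚ) (Lsharp Lflat : IwasawaAlgebra p),
      IsNewformOf W f → (ϖ : ℝ) * W.realPeriodRat = plusPeriod f →
      IsSprungPair f p (W.frobeniusTrace p) Lsharp Lflat → chromaticL col Lsharp Lflat ≠ 0 →
    ∀ (D : SharpFlatSelmerDualData W κ γ (closureEmb (K := ℚ) (v.adicCompletion ℚ))
        (W.frobeniusTrace p) g c col) [Module.Finite (IwasawaAlgebra p) D.X],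
      Module.IsTorsion (IwasawaAlgebra p) D.X →
    ∀ (G : IwasawaAlgebra p),
      iwasawaToPowerSeries p G =
        PowerSeries.C (ϖ : ℚ_[p]) * iwasawaToPowerSeries p (chromaticL col Lsharp Lflat) →
    ∀ (I : Kato2004.IwasawaH1Data W p κ γ)
      (Cs : SharpFlatColemanKatoData W p f ϖ κ γ (closureEmb (K := ℚ) (v.adicCompletion ℚ))
        (W.frobeniusTrace p) g c Chroma.sharp I)
      (Cf : SharpFlatColemanKatoData W p f ϖ κ γ (closureEmb (K := ℚ) (v.adicCompletion ℚ))
        (W.frobeniusTrace p) g c Chroma.flat I),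
      Cs.Z = Cf.Z →
      (∃ (a b : IwasawaAlgebra p) (k : ℕ), a * Lsharp + b * Lflat = PowerSeries.C ((p : ℤ_[p]) ^ k)) →
      ∃ gen h : IwasawaAlgebra p, D.charIdeal = Ideal.span {gen} ∧
        iwasawaToPowerSeries p gen =
          PowerSeries.C (ϖ : ℚ_[p]) * iwasawaToPowerSeries p (chromaticL col Lsharp Lflat * h) := by
  intro W _ _ p _ _ _ _ hX col κ γ hκ hγ hcv v hv g hg cneg c hH N hN f ϖ Lsharp Lflat hf hϖ hSP
    hcol D _ hXt G hG I Cs Cf hZ hbez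
  refine stub_squeezeToCommonZeros W p hX col κ γ hκ hγ hcv v hv g hg cneg c hH N hN f ϖ Lsharp Lflat
    hf hϖ hSP hcol D hXt G hG I Cs Cf hZ ?_
  intro 𝔭 h𝔭 hcommon
  exact (no_common_zero_of_bezout h3 W p hX f ϖ Lsharp Lflat hf hϖ hSP hbez 𝔭 h𝔭 hcommon).elim

end Summit.BirchSwinnertonDyer.BirchSwinnertonDyer.Theorems.ChromaticCommonZeros

end
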